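import Literature.NumberTheory.LFunctions.WeilCombTwoPointExtraction
import Literature.NumberTheory.Sieve.SelbergSymmetryFormula
import HarnessLib

/-!
# Node weights of `ζ`-mollified combs, XII: local summability from the two-point comb inequalities

Topic `Literature/NumberTheory/LFunctions`.  THE CONCLUSION OF THE TWO-POINT COMB: along the comb
family with window `h = √(log M)/M` and `N = 3pM` nodes, the extraction of
`Literature/NumberTheory/LFunctions/WeilCombTwoPointExtraction.lean` bounds
`∑_{n ≤ √Y_M, p ∣ n} c(n)/n` uniformly in `M` (`Y_M = M/(4√(log M)) → ∞`), because every other term of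
the comb inequality is `O(log M)` while the divergent term carries the factor `log Y_M ≥ (log M)/2`.
Hence, for a nonnegative weight `c` with Chebyshev and Mertens-level information, the comb
inequalities of the design `δ₁ + δ_p` for all large `M` force `∑_{p ∣ n} c(n)/n < ∞`:

* `comb_params_of_large` — the parameter facts for `M ≥ 4096 p²`;
* `two_point_bound_of_large` — the uniform bound on `∑_{n ≤ ⌊√Y_M⌋, p ∣ n} c(n)/n`;
* `summable_of_comb_inequalities` — the summability.

Everything is proved; no named facts.
-/

noncomputable section

open MeasureTheory Set
open scoped ArithmeticFunction.vonMangoldt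

namespace Literature.NumberTheory.LFunctions

/-! ## Parameters along `h = √(log M)/M` -/

/-- **Parameter facts for `M ≥ 4096p²`** (`p ≥ 1`), with `κ = √(log M)`, `h = κ/M`:
`1 ≤ log M`, `1 ≤ κ ≤ log M`, `0 < h ≤ 1/(32p)`, `1 ≤ hM`, `h²M ≤ 1`, `h ≤ 1/2`,
`1/(4h) = M/(4κ)`, `√M ≤ M/(4κ) ≤ M`. [folklore] -/
theorem comb_params_of_large {p M : ℕ} (hp : 1 ≤ p) (hM : 4096 * p ^ 2 ≤ M) :
    1 ≤ Real.log M ∧ 1 ≤ Real.sqrt (Real.log M) ∧ Real.sqrt (Real.log M) ≤ Real.log M ∧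
      0 < Real.sqrt (Real.log M) / M ∧ Real.sqrt (Real.log M) / M ≤ 1 / (32 * p) ∧
      1 ≤ Real.sqrt (Real.log M) / M * M ∧ (Real.sqrt (Real.log M) / M) ^ 2 * M ≤ 1 ∧
      Real.sqrt (Real.log M) / M ≤ 1 / 2 ∧
      1 / (4 * (Real.sqrt (Real.log M) / M)) = M / (4 * Real.sqrt (Real.log M)) ∧
      Real.sqrt M ≤ M / (4 * Real.sqrt (Real.log M)) ∧ M / (4 * Real.sqrt (Real.log M)) ≤ M := by
  have hpR : (1 : ℝ) ≤ p := by exact_mod_cast hp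
  have hMR : (4096 : ℝ) * p ^ 2 ≤ M := by exact_mod_cast hM
  have hM4096 : (4096 : ℝ) ≤ M := le_trans (by nlinarith) hMR
  have hM0 : (0 : ℝ) < M := by linarith
  -- `log M ≥ 1`
  have hlog3 : (1 : ℝ) ≤ Real.log M := by
    rw [Real.le_log_iff_exp_le hM0]
    exact le_trans Real.exp_one_lt_d9.le (by linarith)
  set κ : ℝ := Real.sqrt (Real.log M) with hκ
  have hκ1 : 1 ≤ κ := by rw [hκ, Real.le_sqrt' one_pos]; simpa using hlog3
  have hκ0 : 0 < κ := by linarith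
  have hκsq : κ * κ = Real.log M := Real.mul_self_sqrt (by linarith)
  have hκlog : κ ≤ Real.log M := by nlinarith
  -- `log M ≤ 2√M`, `√M ≥ 64p`
  have hsM : 64 * (p : ℝ) ≤ Real.sqrt M := by
    rw [Real.le_sqrt (by positivity) hM0.le]; nlinarith
  have hsM0 : 0 < Real.sqrt M := by linarith
  have hsMsq : Real.sqrt M * Real.sqrt M = M := Real.mul_self_sqrt hM0.le
  have hlog2 : Real.log M ≤ 2 * Real.sqrt M :=
    Literature.NumberTheory.Sieve.SelbergSymmetry.log_le_two_mul_sqrt hM0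
  -- `32pκ ≤ M`
  have h32 : 32 * p * κ ≤ M := by
    calc 32 * (p : ℝ) * κ ≤ 32 * p * (2 * Real.sqrt M) := by
          apply mul_le_mul_of_nonneg_left (hκlog.trans hlog2) (by positivity)
      _ = 64 * p * Real.sqrt M := by ring
      _ ≤ Real.sqrt M * Real.sqrt M := mul_le_mul_of_nonneg_right hsM hsM0.le
      _ = M := hsMsq
  have hh : 0 < κ / M := by positivity
  have hhL : κ / M ≤ 1 / (32 * p) := by
    rw [div_le_div_iff₀ hM0 (by positivity)]; linarith
  have hhM : 1 ≤ κ / M * M := by rw [div_mul_cancel₀ _ hM0.ne']; exact hκ1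
  have hhM2 : (κ / M) ^ 2 * M ≤ 1 := by
    rw [div_pow, sq, hκsq, div_mul_eq_mul_div, div_le_one (by positivity)]
    have := Real.log_le_sub_one_of_pos hM0
    nlinarith
  have hh2 : κ / M ≤ 1 / 2 := hhL.trans (by
    rw [div_le_div_iff₀ (by positivity) (by norm_num)]; linarith)
  have hYeq : 1 / (4 * (κ / M)) = M / (4 * κ) := by field_simp
  -- `√M ≤ M/(4κ)`: `4κ√M ≤ M` from `κ ≤ √M/... `: `16κ² = 16 log M ≤ 32√M ≤ M`
  have hY1 : Real.sqrt M ≤ M / (4 * κ) := by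
    rw [le_div_iff₀ (by positivity)]
    have h4κ : 4 * κ ≤ Real.sqrt M := by
      -- `(4κ)² = 16 log M ≤ 32 √M ≤ √M · √M`
      have h1 : (4 * κ) * (4 * κ) ≤ Real.sqrt M * Real.sqrt M := by
        calc (4 * κ) * (4 * κ) = 16 * Real.log M := by rw [← hκsq]; ring
          _ ≤ 16 * (2 * Real.sqrt M) := by linarith
          _ ≤ Real.sqrt M * Real.sqrt M := by nlinarith
      nlinarith
    calc Real.sqrt M * (4 * κ) ≤ Real.sqrt M * Real.sqrt M :=
          mul_le_mul_of_nonneg_left h4κ hsM0.le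
      _ = M := hsMsq
  have hY2 : M / (4 * κ) ≤ M := div_le_self hM0.le (by linarith)
  exact ⟨hlog3, hκ1, hκlog, hh, hhL, hhM, hhM2, hh2, hYeq, hY1, hY2⟩

/-! ## Sizes of the terms of the extraction along the family -/

/-- **Every term of the two-point extraction is `O(1 + log M)` along `h = √(log M)/M`, `N = 3pM`.**
[folklore] -/
theorem comb_sizes_of_large {N₀ N₁ N₂ A₁ T₀ B0 : ℝ} {p M : ℕ} (hp : 2 ≤ p) (hM : 4096 * p ^ 2 ≤ M)
    (hN₀ : 0 ≤ N₀) (hN₁ : 0 ≤ N₁) (hN₂ : 0 ≤ N₂) (hA₁ : 0 ≤ A₁) (hT₀ : 0 ≤ T₀) (hB0 : 0 ≤ B0) :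
    B0 * p * (1 + Real.log (1 / (4 * (Real.sqrt (Real.log M) / M))))
        + 8 * N₀ * p * (Real.sqrt (Real.log M) / M) * M
        + (8 * ((N₀ + 2 * N₁ + N₂) * (96 + 192 * p) * p ^ 2) * p + 64 * N₀ * p ^ 2)
        + 8 * N₀ * p * (Real.sqrt (Real.log M) / M)
      ≤ (B0 * p + 16 * N₀ * p + (8 * ((N₀ + 2 * N₁ + N₂) * (96 + 192 * p) * p ^ 2) * p + 64 * N₀ * p ^ 2))
          * (1 + Real.log M) ∧
    (8 * ((N₀ + 2 * N₁ + N₂) * (96 + 192 * p) * p ^ 2) * p + 64 * N₀ * p ^ 2) *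
          ((A₁ + (Real.log 4 + 4)) * (1 + Real.log ((3 * p * M : ℕ) : ℝ)))
        + 8 * N₀ * p * (Real.sqrt (Real.log M) / M) * ((A₁ + (Real.log 4 + 4)) * ((3 * p * M : ℕ) : ℝ))
        + 8 * N₀ * p * (Real.sqrt (Real.log M) / M) * M *
          ((2 * T₀ + 3 * (A₁ + (Real.log 4 + 4))) * p + (T₀ + (A₁ + (Real.log 4 + 4))))
      ≤ ((8 * ((N₀ + 2 * N₁ + N₂) * (96 + 192 * p) * p ^ 2) * p + 64 * N₀ * p ^ 2) *
            ((A₁ + (Real.log 4 + 4)) * (1 + Real.log (3 * p)))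
          + 8 * N₀ * p * ((A₁ + (Real.log 4 + 4)) * (3 * p))
          + 8 * N₀ * p * ((2 * T₀ + 3 * (A₁ + (Real.log 4 + 4))) * p + (T₀ + (A₁ + (Real.log 4 + 4)))))
          * (1 + Real.log M) ∧
    B0 * (1 + Real.log (1 / (4 * (Real.sqrt (Real.log M) / M)))) * (3 * T₀ + Real.sqrt p * (T₀ + 2))
      ≤ B0 * (3 * T₀ + Real.sqrt p * (T₀ + 2)) * (1 + Real.log M) ∧
    B0 * Real.sqrt p / 16 * (1 + Real.log M)
      ≤ B0 * Real.sqrt p / 4 * Real.log (1 / (4 * (Real.sqrt (Real.log M) / M))) ∧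
    ⌊Real.sqrt (1 / (4 * (Real.sqrt (Real.log M) / M)))⌋₊ ≤ 3 * p * M ∧ 1 ≤ 3 * p * M := by
  have hp1 : 1 ≤ p := le_trans (by norm_num) hp
  have hpR : (2 : ℝ) ≤ p := by exact_mod_cast hp
  have hp0 : (0 : ℝ) < p := by linarith
  have hl4 : 0 ≤ Real.log 4 := Real.log_nonneg (by norm_num)
  have hl3p : 0 ≤ Real.log (3 * p) := Real.log_nonneg (by linarith)
  obtain ⟨hlog1, hκ1, hκlog, hh, hhL, hhM, hhM2, hh2, hYeq, hY1, hY2⟩ := comb_params_of_large hp1 hM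
  have hM1 : (1 : ℝ) ≤ M := by
    have h1 : (4096 : ℝ) * p ^ 2 ≤ M := by exact_mod_cast hM
    have h2 : (1 : ℝ) ≤ 4096 * p ^ 2 := by nlinarith
    linarith
  have hM0 : (0 : ℝ) < M := by linarith
  set κ : ℝ := Real.sqrt (Real.log M) with hκ
  set h : ℝ := κ / M with hhdef
  clear_value h κ
  set Φ : ℝ := 1 + Real.log M with hΦ
  clear_value Φ
  have hΦ1 : 1 ≤ Φ := by rw [hΦ]; linarith
  have hΦ0 : 0 ≤ Φ := by linarith
  have hNR : ((3 * p * M : ℕ) : ℝ) = 3 * p * M := by push_cast; ring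
  have hlogY_le : Real.log (1 / (4 * h)) ≤ Real.log M := by
    rw [hYeq]; exact Real.log_le_log (by positivity) hY2
  have hlogY_ge : Real.log M / 2 ≤ Real.log (1 / (4 * h)) := by
    rw [hYeq, ← Real.log_sqrt hM0.le]
    exact Real.log_le_log (Real.sqrt_pos.2 hM0) hY1
  have hlogY0 : 0 ≤ Real.log (1 / (4 * h)) := by linarith
  have hY1' : 1 + Real.log (1 / (4 * h)) ≤ Φ := by rw [hΦ]; linarith
  have hlogN : 1 + Real.log ((3 * p * M : ℕ) : ℝ) ≤ (1 + Real.log (3 * p)) * Φ := by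
    rw [hNR, Real.log_mul (by positivity) hM0.ne', hΦ]
    have : 0 ≤ Real.log (3 * p) * Real.log M := mul_nonneg hl3p (by linarith)
    nlinarith
  have hhMκ : h * M = κ := by rw [hhdef, div_mul_cancel₀ _ hM0.ne']
  have hκΦ : κ ≤ Φ := by rw [hΦ]; linarith
  have hhN : h * ((3 * p * M : ℕ) : ℝ) ≤ 3 * p * Φ := by
    rw [hNR, show h * (3 * p * (M : ℝ)) = 3 * p * (h * M) by ring, hhMκ]
    exact mul_le_mul_of_nonneg_left hκΦ (by positivity)
  have hhM' : h * M ≤ Φ := by rw [hhMκ]; exact hκΦ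
  have hh1 : h ≤ Φ := le_trans (by linarith) hΦ1
  set C3 : ℝ := 8 * ((N₀ + 2 * N₁ + N₂) * (96 + 192 * p) * p ^ 2) * p + 64 * N₀ * p ^ 2 with hC3
  clear_value C3
  have hC30 : 0 ≤ C3 := by rw [hC3]; positivity
  set AΛ : ℝ := A₁ + (Real.log 4 + 4) with hAΛ
  clear_value AΛ
  have hAΛ0 : 0 ≤ AΛ := by rw [hAΛ]; positivity
  refine ⟨?_, ?_, ?_, ?_, ?_, ?_⟩
  · have t1 : B0 * p * (1 + Real.log (1 / (4 * h))) ≤ B0 * p * Φ :=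
      mul_le_mul_of_nonneg_left hY1' (by positivity)
    have t2 : 8 * N₀ * p * h * M ≤ 8 * N₀ * p * Φ := by
      rw [mul_assoc (8 * N₀ * p)]; exact mul_le_mul_of_nonneg_left hhM' (by positivity)
    have t3 : C3 ≤ C3 * Φ := le_mul_of_one_le_right hC30 hΦ1
    have t4 : 8 * N₀ * p * h ≤ 8 * N₀ * p * Φ := mul_le_mul_of_nonneg_left hh1 (by positivity)
    have e : (B0 * p + 16 * N₀ * p + C3) * Φ = B0 * p * Φ + 8 * N₀ * p * Φ + C3 * Φ + 8 * N₀ * p * Φ := by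
      ring
    rw [e]; linarith
  · have t1 : C3 * (AΛ * (1 + Real.log ((3 * p * M : ℕ) : ℝ))) ≤ C3 * (AΛ * ((1 + Real.log (3 * p)) * Φ)) :=
      mul_le_mul_of_nonneg_left (mul_le_mul_of_nonneg_left hlogN hAΛ0) hC30
    have t2 : 8 * N₀ * p * h * (AΛ * ((3 * p * M : ℕ) : ℝ)) ≤ 8 * N₀ * p * (AΛ * (3 * p)) * Φ := by
      have := mul_le_mul_of_nonneg_left hhN (by positivity : 0 ≤ 8 * N₀ * p * AΛ)
      calc 8 * N₀ * p * h * (AΛ * ((3 * p * M : ℕ) : ℝ)) = 8 * N₀ * p * AΛ * (h * ((3 * p * M : ℕ) : ℝ)) := by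
            ring
        _ ≤ 8 * N₀ * p * AΛ * (3 * p * Φ) := this
        _ = 8 * N₀ * p * (AΛ * (3 * p)) * Φ := by ring
    set W : ℝ := (2 * T₀ + 3 * AΛ) * p + (T₀ + AΛ) with hW
    clear_value W
    have hW0 : 0 ≤ W := by rw [hW]; positivity
    have t3 : 8 * N₀ * p * h * M * W ≤ 8 * N₀ * p * W * Φ := by
      have := mul_le_mul_of_nonneg_left hhM' (by positivity : 0 ≤ 8 * N₀ * p * W)
      calc 8 * N₀ * p * h * M * W = 8 * N₀ * p * W * (h * M) := by ring
        _ ≤ 8 * N₀ * p * W * Φ := this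
    have e : (C3 * (AΛ * (1 + Real.log (3 * p))) + 8 * N₀ * p * (AΛ * (3 * p)) + 8 * N₀ * p * W) * Φ
        = C3 * (AΛ * ((1 + Real.log (3 * p)) * Φ)) + 8 * N₀ * p * (AΛ * (3 * p)) * Φ + 8 * N₀ * p * W * Φ := by
      ring
    rw [e]; linarith
  · have hpos : 0 ≤ B0 * (3 * T₀ + Real.sqrt p * (T₀ + 2)) := by positivity
    have := mul_le_mul_of_nonneg_left hY1' hpos
    calc B0 * (1 + Real.log (1 / (4 * h))) * (3 * T₀ + Real.sqrt p * (T₀ + 2))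
        = B0 * (3 * T₀ + Real.sqrt p * (T₀ + 2)) * (1 + Real.log (1 / (4 * h))) := by ring
      _ ≤ B0 * (3 * T₀ + Real.sqrt p * (T₀ + 2)) * Φ := this
  · have : Φ / 4 ≤ Real.log (1 / (4 * h)) := by rw [hΦ]; linarith
    have hpos : 0 ≤ B0 * Real.sqrt p := by positivity
    calc B0 * Real.sqrt p / 16 * Φ = B0 * Real.sqrt p / 4 * (Φ / 4) := by ring
      _ ≤ B0 * Real.sqrt p / 4 * Real.log (1 / (4 * h)) := mul_le_mul_of_nonneg_left this (by positivity)
  · have : (⌊Real.sqrt (1 / (4 * h))⌋₊ : ℝ) ≤ 3 * p * M := by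
      calc (⌊Real.sqrt (1 / (4 * h))⌋₊ : ℝ) ≤ Real.sqrt (1 / (4 * h)) := Nat.floor_le (Real.sqrt_nonneg _)
        _ ≤ 1 / (4 * h) := by
            rw [Real.sqrt_le_left (by positivity)]
            have hY : 1 ≤ 1 / (4 * h) := by
              rw [hYeq]; exact le_trans (by rw [Real.le_sqrt' one_pos]; simpa using hM1) hY1
            have h0 : 0 ≤ 1 / (4 * h) := by positivity
            calc 1 / (4 * h) = 1 / (4 * h) * 1 := (mul_one _).symm
              _ ≤ 1 / (4 * h) * (1 / (4 * h)) := mul_le_mul_of_nonneg_left hY h0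
              _ = (1 / (4 * h)) ^ 2 := (sq _).symm
        _ = M / (4 * κ) := hYeq
        _ ≤ M := hY2
        _ ≤ 3 * p * M := by
            have : (1 : ℝ) * M ≤ 3 * p * M := mul_le_mul_of_nonneg_right (by linarith) hM0.le
            linarith
    rw [← hNR] at this
    exact_mod_cast this
  · have : (1 : ℝ) ≤ 3 * p * M := by
      have : (1 : ℝ) * 1 ≤ 3 * p * M := mul_le_mul (by linarith) hM1 zero_le_one (by positivity)
      linarith
    exact_mod_cast this

/-! ## The uniform bound -/

/-- **The uniform bound along the comb family.**  Under the hypotheses of `two_point_extraction`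
(with `B(0) > 0`), if the comb inequality of the design `δ₁ + δ_p` holds at `M ≥ 4096p²` with
`h = √(log M)/M`, `N = 3pM`, `R = 0`, then
`∑_{n ≤ ⌊√(M/(4√(log M)))⌋, p ∣ n} c(n)/n ≤ 16 Γ/(B(0)√p)` with `Γ` independent of `M`. [folklore] -/
theorem two_point_bound_of_large {B B' B'' : ℝ → ℝ} {N₀ N₁ N₂ A₁ T₀ : ℝ} {p M : ℕ} {c : ℕ → ℝ}
    (hB : ∀ x, HasDerivAt B (B' x) x) (hB' : ∀ x, HasDerivAt B' (B'' x) x)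
    (h0 : ∀ x, |B x| ≤ N₀) (h1 : ∀ x, |B' x| ≤ N₁) (h2 : ∀ x, |B'' x| ≤ N₂)
    (hBs : ∀ x, 2 < |x| → B x = 0) (hB0 : ∀ x, 0 ≤ B x) (hBpos : 0 < B 0)
    (hp : p.Prime) (hc0 : ∀ n, 0 ≤ c n) (hA₁ : ∀ N : ℕ, 1 ≤ N → ∑ n ∈ Finset.Icc 1 N, c n ≤ A₁ * N)
    (hT : ∀ N : ℕ, |∑ n ∈ Finset.Icc 1 N, (c n - Λ n) / n| ≤ T₀) (hM : 4096 * p ^ 2 ≤ M)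
    (V : ℕ → ℕ → ℕ → ℝ)
    (hV : ∀ ℓ ℓ' n : ℕ, V ℓ ℓ' n = ∑ k' ∈ Finset.Icc 1 M,
      (∑ k ∈ Finset.Icc 1 M, B ((Real.log ((n : ℝ) * ℓ' * k' / ℓ) - Real.log k)
          / (Real.sqrt (Real.log M) / M)) / Real.sqrt k) / Real.sqrt k' / Real.sqrt n)
    (hcomb : (∑ n ∈ Finset.Icc 1 (3 * p * M), c n * V 1 1 n - ∑ n ∈ Finset.Icc 1 (3 * p * M), (Λ n : ℝ) * V 1 1 n)
      + (∑ n ∈ Finset.Icc 1 (3 * p * M), c n * V 1 p n - ∑ n ∈ Finset.Icc 1 (3 * p * M), (Λ n : ℝ) * V 1 p n)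
      + (∑ n ∈ Finset.Icc 1 (3 * p * M), c n * V p 1 n - ∑ n ∈ Finset.Icc 1 (3 * p * M), (Λ n : ℝ) * V p 1 n)
      + (∑ n ∈ Finset.Icc 1 (3 * p * M), c n * V p p n - ∑ n ∈ Finset.Icc 1 (3 * p * M), (Λ n : ℝ) * V p p n)
      ≤ V 1 1 1 + V 1 p 1 + V p 1 1 + V p p 1) :
    ∑ n ∈ Finset.Icc 1 ⌊Real.sqrt (M / (4 * Real.sqrt (Real.log M)))⌋₊, (if p ∣ n then c n / n else 0)
      ≤ 16 / (B 0 * Real.sqrt p) *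
        (4 * (B 0 * p + 16 * N₀ * p + (8 * ((N₀ + 2 * N₁ + N₂) * (96 + 192 * p) * p ^ 2) * p + 64 * N₀ * p ^ 2))
          + 4 * ((8 * ((N₀ + 2 * N₁ + N₂) * (96 + 192 * p) * p ^ 2) * p + 64 * N₀ * p ^ 2) *
                  ((A₁ + (Real.log 4 + 4)) * (1 + Real.log (3 * p)))
                + 8 * N₀ * p * ((A₁ + (Real.log 4 + 4)) * (3 * p))
                + 8 * N₀ * p * ((2 * T₀ + 3 * (A₁ + (Real.log 4 + 4))) * p + (T₀ + (A₁ + (Real.log 4 + 4)))))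
          + B 0 * (3 * T₀ + Real.sqrt p * (T₀ + 2))) := by
  have hp1 : 1 ≤ p := hp.one_lt.le
  have hp0 : (0 : ℝ) < p := by exact_mod_cast hp.pos
  have hN₀ : 0 ≤ N₀ := (abs_nonneg _).trans (h0 0)
  have hN₁ : 0 ≤ N₁ := (abs_nonneg _).trans (h1 0)
  have hN₂ : 0 ≤ N₂ := (abs_nonneg _).trans (h2 0)
  have hT0 : 0 ≤ T₀ := (abs_nonneg _).trans (hT 0)
  have hA0 : 0 ≤ A₁ := by
    have := hA₁ 1 le_rfl
    simp only [Finset.Icc_self, Finset.sum_singleton, Nat.cast_one, mul_one] at this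
    exact (hc0 1).trans this
  obtain ⟨-, -, -, hh, hhL, hhM, hhM2, -, hYeq, -, -⟩ := comb_params_of_large hp1 hM
  obtain ⟨sVb, sΔ, sE, scoef, hNY, hN1⟩ := comb_sizes_of_large hp.two_le hM hN₀ hN₁ hN₂ hA0 hT0 hBpos.le
  have hext := two_point_extraction (R := 0) hB hB' h0 h1 h2 hBs hB0 hp hh hhL hhM hhM2 hc0 hA₁ hT hN1 hNY
    V hV (by rw [add_zero]; exact hcomb)
  clear hcomb hV
  rw [zero_add] at hext
  -- abbreviate
  set Φ : ℝ := 1 + Real.log M with hΦ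
  set S : ℝ := ∑ n ∈ Finset.Icc 1 ⌊Real.sqrt (1 / (4 * (Real.sqrt (Real.log M) / M)))⌋₊,
    (if p ∣ n then c n / n else 0) with hS
  set Vb0 : ℝ := B 0 * p + 16 * N₀ * p
    + (8 * ((N₀ + 2 * N₁ + N₂) * (96 + 192 * p) * p ^ 2) * p + 64 * N₀ * p ^ 2) with hVb0
  set Δ0 : ℝ := (8 * ((N₀ + 2 * N₁ + N₂) * (96 + 192 * p) * p ^ 2) * p + 64 * N₀ * p ^ 2) *
      ((A₁ + (Real.log 4 + 4)) * (1 + Real.log (3 * p)))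
    + 8 * N₀ * p * ((A₁ + (Real.log 4 + 4)) * (3 * p))
    + 8 * N₀ * p * ((2 * T₀ + 3 * (A₁ + (Real.log 4 + 4))) * p + (T₀ + (A₁ + (Real.log 4 + 4)))) with hΔ0
  set E0 : ℝ := B 0 * (3 * T₀ + Real.sqrt p * (T₀ + 2)) with hE0
  clear_value Φ Vb0 Δ0 E0
  have hS0 : 0 ≤ S := Finset.sum_nonneg fun n _ ↦ by
    split_ifs
    · exact div_nonneg (hc0 n) (Nat.cast_nonneg n)
    · exact le_rfl
  have h3 := add_le_add (add_le_add (mul_le_mul_of_nonneg_left sVb (by norm_num : (0 : ℝ) ≤ 4))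
    (mul_le_mul_of_nonneg_left sΔ (by norm_num : (0 : ℝ) ≤ 4))) sE
  have hmain : B 0 * Real.sqrt p / 16 * Φ * S ≤ (4 * Vb0 + 4 * Δ0 + E0) * Φ :=
    le_trans (mul_le_mul_of_nonneg_right scoef hS0) (le_trans hext (le_trans h3 (le_of_eq (by ring))))
  clear hext h3 sVb sΔ sE scoef
  have hsp : 0 < Real.sqrt (p : ℝ) := Real.sqrt_pos.2 hp0
  have hΦ0 : 0 < Φ := by
    have hM1 : (1 : ℝ) ≤ M := by
      have h1 : (4096 : ℝ) * p ^ 2 ≤ M := by exact_mod_cast hM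
      have hp1R : (1 : ℝ) ≤ p := by exact_mod_cast hp1
      have h2 : (1 : ℝ) ≤ 4096 * p ^ 2 := by nlinarith
      linarith
    have : 0 ≤ Real.log (M : ℝ) := Real.log_nonneg hM1
    rw [hΦ]; linarith
  have hden : 0 < B 0 * Real.sqrt p / 16 * Φ := by positivity
  have hSle : S ≤ (4 * Vb0 + 4 * Δ0 + E0) * Φ / (B 0 * Real.sqrt p / 16 * Φ) := by
    rw [le_div_iff₀ hden, mul_comm]; exact hmain
  have hsimp : (4 * Vb0 + 4 * Δ0 + E0) * Φ / (B 0 * Real.sqrt p / 16 * Φ)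
      = 16 / (B 0 * Real.sqrt p) * (4 * Vb0 + 4 * Δ0 + E0) := by
    field_simp
  rw [hsimp] at hSle
  have hcut : ⌊Real.sqrt (M / (4 * Real.sqrt (Real.log M)))⌋₊
      = ⌊Real.sqrt (1 / (4 * (Real.sqrt (Real.log M) / M)))⌋₊ := by rw [hYeq]
  rw [hcut]
  exact hSle

/-! ## Summability -/

/-- The cut-off `⌊√(M/(4√(log M)))⌋` exceeds `K` once `M ≥ K⁴` (and `M ≥ 4096p²`). [folklore] -/
theorem le_floor_sqrt_cutoff {p M K : ℕ} (hp : 1 ≤ p) (hM : 4096 * p ^ 2 ≤ M) (hK : K ^ 4 ≤ M) :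
    K ≤ ⌊Real.sqrt (M / (4 * Real.sqrt (Real.log M)))⌋₊ := by
  obtain ⟨-, -, -, -, -, -, -, -, -, hY1, -⟩ := comb_params_of_large hp hM
  apply Nat.le_floor
  have hKR : ((K : ℝ) ^ 2) ^ 2 ≤ M := by
    have : ((K ^ 4 : ℕ) : ℝ) ≤ M := by exact_mod_cast hK
    push_cast at this; nlinarith
  have h1 : (K : ℝ) ^ 2 ≤ Real.sqrt M := by
    rw [Real.le_sqrt (by positivity) (Nat.cast_nonneg M)]; exact hKR
  have h2 : (K : ℝ) ≤ Real.sqrt (Real.sqrt M) := by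
    rw [Real.le_sqrt (Nat.cast_nonneg K) (Real.sqrt_nonneg _)]; exact h1
  exact h2.trans (Real.sqrt_le_sqrt hY1)

/-- **Local summability from the two-point comb inequalities.**  Let `B` be a `C²` bump
autocorrelation (`B ≥ 0`, `B(0) > 0`, supported in `[-2,2]`), `p` prime, `c ≥ 0` with
`∑_{n ≤ N} c(n) ≤ A₁N` (`N ≥ 1`) and `|∑_{n ≤ N} (c(n) - Λ(n))/n| ≤ T₀` (all `N`).  If for all large
`M` the node sums of the comb with window `h = √(log M)/M` satisfy the comb inequality of the design
`δ₁ + δ_p` with `3pM` nodes, then `∑_{p ∣ n} c(n)/n < ∞`. [folklore] -/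
theorem summable_of_comb_inequalities {B B' B'' : ℝ → ℝ} {N₀ N₁ N₂ A₁ T₀ : ℝ} {p : ℕ} {c : ℕ → ℝ}
    (hB : ∀ x, HasDerivAt B (B' x) x) (hB' : ∀ x, HasDerivAt B' (B'' x) x)
    (h0 : ∀ x, |B x| ≤ N₀) (h1 : ∀ x, |B' x| ≤ N₁) (h2 : ∀ x, |B'' x| ≤ N₂)
    (hBs : ∀ x, 2 < |x| → B x = 0) (hB0 : ∀ x, 0 ≤ B x) (hBpos : 0 < B 0)
    (hp : p.Prime) (hc0 : ∀ n, 0 ≤ c n) (hA₁ : ∀ N : ℕ, 1 ≤ N → ∑ n ∈ Finset.Icc 1 N, c n ≤ A₁ * N)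
    (hT : ∀ N : ℕ, |∑ n ∈ Finset.Icc 1 N, (c n - Λ n) / n| ≤ T₀)
    (hcomb : ∃ M₁ : ℕ, ∀ M : ℕ, M₁ ≤ M → ∀ V : ℕ → ℕ → ℕ → ℝ,
      (∀ ℓ ℓ' n : ℕ, V ℓ ℓ' n = ∑ k' ∈ Finset.Icc 1 M,
        (∑ k ∈ Finset.Icc 1 M, B ((Real.log ((n : ℝ) * ℓ' * k' / ℓ) - Real.log k)
            / (Real.sqrt (Real.log M) / M)) / Real.sqrt k) / Real.sqrt k' / Real.sqrt n) →
      (∑ n ∈ Finset.Icc 1 (3 * p * M), c n * V 1 1 n - ∑ n ∈ Finset.Icc 1 (3 * p * M), (Λ n : ℝ) * V 1 1 n)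
        + (∑ n ∈ Finset.Icc 1 (3 * p * M), c n * V 1 p n - ∑ n ∈ Finset.Icc 1 (3 * p * M), (Λ n : ℝ) * V 1 p n)
        + (∑ n ∈ Finset.Icc 1 (3 * p * M), c n * V p 1 n - ∑ n ∈ Finset.Icc 1 (3 * p * M), (Λ n : ℝ) * V p 1 n)
        + (∑ n ∈ Finset.Icc 1 (3 * p * M), c n * V p p n - ∑ n ∈ Finset.Icc 1 (3 * p * M), (Λ n : ℝ) * V p p n)
        ≤ V 1 1 1 + V 1 p 1 + V p 1 1 + V p p 1) :
    Summable (fun n : ℕ ↦ if p ∣ n then c n / n else 0) := by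
  obtain ⟨M₁, hM₁⟩ := hcomb
  have hp1 : 1 ≤ p := hp.one_lt.le
  have ha0 : ∀ n : ℕ, 0 ≤ (if p ∣ n then c n / n else 0) := fun n ↦ by
    split_ifs
    · exact div_nonneg (hc0 n) (Nat.cast_nonneg n)
    · exact le_rfl
  refine summable_of_sum_range_le (c := 16 / (B 0 * Real.sqrt p) *
        (4 * (B 0 * p + 16 * N₀ * p + (8 * ((N₀ + 2 * N₁ + N₂) * (96 + 192 * p) * p ^ 2) * p + 64 * N₀ * p ^ 2))
          + 4 * ((8 * ((N₀ + 2 * N₁ + N₂) * (96 + 192 * p) * p ^ 2) * p + 64 * N₀ * p ^ 2) *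
                  ((A₁ + (Real.log 4 + 4)) * (1 + Real.log (3 * p)))
                + 8 * N₀ * p * ((A₁ + (Real.log 4 + 4)) * (3 * p))
                + 8 * N₀ * p * ((2 * T₀ + 3 * (A₁ + (Real.log 4 + 4))) * p + (T₀ + (A₁ + (Real.log 4 + 4)))))
          + B 0 * (3 * T₀ + Real.sqrt p * (T₀ + 2)))) ha0 fun K ↦ ?_
  -- a large `M` whose cut-off exceeds `K`
  set M : ℕ := max (max M₁ (4096 * p ^ 2)) (K ^ 4) with hMdef
  have hMM₁ : M₁ ≤ M := le_trans (le_max_left _ _) (le_max_left _ _)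
  have hM4096 : 4096 * p ^ 2 ≤ M := le_trans (le_max_right _ _) (le_max_left _ _)
  have hMK : K ^ 4 ≤ M := le_max_right _ _
  clear_value M
  have hKcut := le_floor_sqrt_cutoff hp1 hM4096 hMK
  set V : ℕ → ℕ → ℕ → ℝ := fun ℓ ℓ' n ↦ ∑ k' ∈ Finset.Icc 1 M,
      (∑ k ∈ Finset.Icc 1 M, B ((Real.log ((n : ℝ) * ℓ' * k' / ℓ) - Real.log k)
          / (Real.sqrt (Real.log M) / M)) / Real.sqrt k) / Real.sqrt k' / Real.sqrt n with hVdef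
  have hV : ∀ ℓ ℓ' n : ℕ, V ℓ ℓ' n = ∑ k' ∈ Finset.Icc 1 M,
      (∑ k ∈ Finset.Icc 1 M, B ((Real.log ((n : ℝ) * ℓ' * k' / ℓ) - Real.log k)
          / (Real.sqrt (Real.log M) / M)) / Real.sqrt k) / Real.sqrt k' / Real.sqrt n := by
    intro ℓ ℓ' n; rw [hVdef]
  clear_value V
  have hcM := hM₁ M hMM₁ V hV
  have hbound := two_point_bound_of_large hB hB' h0 h1 h2 hBs hB0 hBpos hp hc0 hA₁ hT hM4096 V hV hcM
  refine le_trans ?_ hbound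
  -- `∑_{i < K} a(i) ≤ ∑_{1 ≤ i ≤ cut-off} a(i)`
  have hzero : (if p ∣ 0 then c 0 / ((0 : ℕ) : ℝ) else 0) = 0 := by simp
  rw [← Finset.sum_erase (Finset.range K) hzero]
  refine Finset.sum_le_sum_of_subset_of_nonneg (fun i hi ↦ ?_) fun i _ _ ↦ ha0 i
  simp only [Finset.mem_erase, Finset.mem_range] at hi
  rw [Finset.mem_Icc]
  omega

end Literature.NumberTheory.LFunctions
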